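import Summits.Ventures.HodgeRepro.SingleClass

/-!
# No face is single-class, degree 12: `D6`, `c = cc_D6`

Blind re-derivation cell `pub-hodge-repro`, seat `typer` (gen 4).  One of the six degree-12 files
(`SingleClass12C12`, `SingleClass12C6xC2a/b/c`, `SingleClass12D6`, `SingleClass12Dic3`), one file per
`(G, c)` because each `decide +kernel` row enumerates the `4096` subsets of `G` (≈ 10 s) and more than
five such rows in one module overloads a farm node.  Method (`SingleClass.lean`): translation by `p⁻¹`
puts the first place at the identity (`not_isSingleClass_of_one`) and the second place depends only on
its conjugacy class (`faceCorners_conj_right`), so five rows `(Φ; 1, p′)`, one per place other than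
the place of `1`, settle `route/ROUTE.md` §3.4's «NO face … is single-class» for this `(G, c)`.
-/

open Finset
open scoped Pointwise
open Multiplicative

namespace HodgeRepro

/-! ### `D6`, `c = cc_D6` -/
/-- Degree-12 row `D6`: faces `(Φ; 1, DihedralGroup.r 1)` are not single-class (`decide +kernel`). -/
theorem row_D6_r1 : ∀ Φ : Finset D6, IsCMType cc_D6 Φ →
    ¬ IsSingleClass (faceCorners cc_D6 Φ 1 (DihedralGroup.r 1)) := by
  decide +kernel

/-- Degree-12 row `D6`: faces `(Φ; 1, DihedralGroup.r 2)` are not single-class (`decide +kernel`). -/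
theorem row_D6_r2 : ∀ Φ : Finset D6, IsCMType cc_D6 Φ →
    ¬ IsSingleClass (faceCorners cc_D6 Φ 1 (DihedralGroup.r 2)) := by
  decide +kernel

/-- Degree-12 row `D6`: faces `(Φ; 1, DihedralGroup.sr 0)` are not single-class (`decide +kernel`). -/
theorem row_D6_sr0 : ∀ Φ : Finset D6, IsCMType cc_D6 Φ →
    ¬ IsSingleClass (faceCorners cc_D6 Φ 1 (DihedralGroup.sr 0)) := by
  decide +kernel

/-- Degree-12 row `D6`: faces `(Φ; 1, DihedralGroup.sr 1)` are not single-class (`decide +kernel`). -/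
theorem row_D6_sr1 : ∀ Φ : Finset D6, IsCMType cc_D6 Φ →
    ¬ IsSingleClass (faceCorners cc_D6 Φ 1 (DihedralGroup.sr 1)) := by
  decide +kernel

/-- Degree-12 row `D6`: faces `(Φ; 1, DihedralGroup.sr 2)` are not single-class (`decide +kernel`). -/
theorem row_D6_sr2 : ∀ Φ : Finset D6, IsCMType cc_D6 Φ →
    ¬ IsSingleClass (faceCorners cc_D6 Φ 1 (DihedralGroup.sr 2)) := by
  decide +kernel

/-- **No face of `(D6, cc_D6)` is single-class** (assembled from the five rows by the symmetries of
`SingleClass.lean`). -/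
theorem not_isSingleClass_face_D6 : ∀ Φ : Finset D6, IsCMType cc_D6 Φ → ∀ p p' : D6,
    p' ∉ place cc_D6 p → ¬ IsSingleClass (faceCorners cc_D6 Φ p p') := by
  apply not_isSingleClass_of_one cc_D6_isComplexConj
  intro Φ hΦ p' hp'
  have hcases : ∀ q : D6, q ∈ place cc_D6 1 ∨ q = DihedralGroup.r 1 ∨ q = DihedralGroup.r 2 ∨ q = DihedralGroup.sr 0 ∨ q = DihedralGroup.sr 1 ∨ q = DihedralGroup.sr 2 ∨ q = cc_D6 * (DihedralGroup.r 1) ∨ q = cc_D6 * (DihedralGroup.r 2) ∨ q = cc_D6 * (DihedralGroup.sr 0) ∨ q = cc_D6 * (DihedralGroup.sr 1) ∨ q = cc_D6 * (DihedralGroup.sr 2) := by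
    decide
  rcases hcases p' with h | rfl | rfl | rfl | rfl | rfl | rfl | rfl | rfl | rfl | rfl
  · exact absurd h hp'
  · exact row_D6_r1 Φ hΦ
  · exact row_D6_r2 Φ hΦ
  · exact row_D6_sr0 Φ hΦ
  · exact row_D6_sr1 Φ hΦ
  · exact row_D6_sr2 Φ hΦ
  · rw [faceCorners_conj_right cc_D6_isComplexConj]
    exact row_D6_r1 Φ hΦ
  · rw [faceCorners_conj_right cc_D6_isComplexConj]
    exact row_D6_r2 Φ hΦ
  · rw [faceCorners_conj_right cc_D6_isComplexConj]
    exact row_D6_sr0 Φ hΦ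
  · rw [faceCorners_conj_right cc_D6_isComplexConj]
    exact row_D6_sr1 Φ hΦ
  · rw [faceCorners_conj_right cc_D6_isComplexConj]
    exact row_D6_sr2 Φ hΦ

end HodgeRepro
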